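import Literature.Analysis.Potential.HyperbolicBallPoisson
import Mathlib.MeasureTheory.Measure.Haar.Unique
import Mathlib.Analysis.InnerProductSpace.Calculus
import Mathlib.Analysis.Calculus.ParametricIntegral
import Mathlib.Analysis.SpecialFunctions.Log.Deriv
import Mathlib.Analysis.Normed.Group.BallSphere
import HarnessLib

/-!
# The barycentre of the uniform measure on `∂ℍⁿ(ℝ)` — proof of `avgBusemann_critical_iff`
# (Itoh–Satoh 2015, Thm 13, Thm 14 (ii), Ex. 5, specialised to the ball model)

Topic `Analysis/Potential`, namespace `Literature.Analysis.Potential.HyperbolicBall`.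
This file DISCHARGES the named fact
`Literature.Analysis.Potential.HyperbolicBall.avgBusemann_critical_iff` of
`HyperbolicBallPoisson.lean`: for `n ≥ 2`, the `σ̄`-average Busemann function
`B_{σ̄}(y) = ⨍_S log(‖y − θ‖²/(1 − ‖y‖²)) dσ(θ)` of real hyperbolic space in the Poincaré ball has
`y = 0` as its only critical point in the open unit ball, and `D²B_{σ̄}(0)` is positive definite
(`theorem avgBusemann_critical_iff_holds`).

## The argument (Itoh–Satoh's architecture, specialised to `X = ℍⁿ(ℝ)`, `x_o = 0`, `μ = dθ = σ̄`)

* (Def. 5 (iv), (v): `∇B_μ = ∫ ∇B_θ dμ`, `∇dB_μ = ∫ ∇dB_θ dμ`.) On the ball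
  `B_{σ̄}(y) = (σ(S))⁻¹ ∫_S log ‖y − θ‖² dσ(θ) − log(1 − ‖y‖²)`; we differentiate twice under the
  integral sign on the compact sphere (`hasFDerivAt_integral_of_dominated_of_fderiv_le`), with
  `∇_y log ‖y−θ‖² = (2/‖y−θ‖²)⟪y−θ, ·⟫` and its derivative
  `(2/‖y−θ‖²)⟪·,·⟫ − (4/‖y−θ‖⁴)⟪y−θ,·⟫⟪y−θ,·⟫`.
* (Ex. 5: `bar(dθ) = x_o`.) `dB_{σ̄}(0) = −2 (σ(S))⁻¹ ∫_S ⟪θ, ·⟫ dσ(θ) = 0` by the antipodal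
  symmetry `θ ↦ −θ` of `σ` (`measurePreserving_neg_toSphere`, from
  `toSphere s = n · vol((0,1)·s)` and `−`-invariance of Lebesgue measure).
* (Thm 14 (ii), via Ex. 4 `∇dB_θ = g − dB_θ ⊗ dB_θ`.) At the barycentre,
  `D²B_{σ̄}(0)[v,v] = (σ(S))⁻¹ ∫_S (4‖v‖² − 4⟪θ,v⟫²) dσ(θ)`, which is `> 0` for `v ≠ 0` because the
  integrand is `≥ 0` and strictly positive on the open, non-empty (here `n ≥ 2` enters) set of
  directions off the axis `ℝv`, which `σ` charges (`toSphere.instIsOpenPosMeasure`).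
* (Thm 13, uniqueness: strict convexity of `B_μ` along the geodesic joining two critical points.)
  Along the radial geodesic from `0` through `y ≠ 0` we show directly `dB_{σ̄}(y)[y] > 0`: pairing
  `θ` with `−θ`, `dB_θ(y)[y] + dB_{−θ}(y)[y] + 4|y|²/(1−|y|²)
    = 8(1+|y|²)(|y|² − ⟪θ,y⟫²)/(‖y−θ‖²‖y+θ‖²(1−|y|²)) ≥ 0`,
  strictly off the axis `ℝy`; so `dB_{σ̄}(y) ≠ 0` for `0 < ‖y‖ < 1`.

Design: the real inner product enters through Mathlib's genuinely bilinear continuous map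
`L = (isBoundedBilinearMap_inner (𝕜 := ℝ)).toContinuousLinearMap : E →L[ℝ] E →L[ℝ] ℝ`
(`E = EuclideanSpace ℝ (Fin n)`), carried through `section Bilinear` as a variable `L` with the
hypothesis `hL : L = …` purely for readability (Mathlib's `innerSL ℝ` is typed
conjugate-semilinear in its first slot, which defeats rewriting once it appears as a bilinear
object). The sphere is `sphere (0 : E) 1` with Mathlib's surface measure `volume.toSphere`
(a constant multiple of the normalised `σ̄`; every statement here is invariant under scaling `σ`).

Deliberately NOT here: general Hadamard manifolds, the Fisher-metric part of the paper (Thm 1,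
Thm 15–16), existence of barycentres for general `μ` (Thm 12), the value `D²B_{σ̄}(0) = 4(1−1/n) I`.

## References

* M. Itoh, H. Satoh, *Geometry of Fisher information metric and the barycenter map*, Entropy 17
  (2015) 1814–1849, doi:10.3390/e17041814 — Def. 5, Ex. 2, 4, 5, Prop. 6, Thm 13, Thm 14 (ii).
  [key `ItohSatoh2015`]
* M. Stoll, *Harmonic and Subharmonic Function Theory on the Hyperbolic Ball*, LMS Lecture Note
  Ser. 431 (2016), §5.1 (the ball model conventions of `HyperbolicBallPoisson.lean`). [key `Stoll2016`]
-/

noncomputable section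

open MeasureTheory Metric Set Filter
open scoped Pointwise RealInnerProductSpace Topology

namespace Literature.Analysis.Potential.HyperbolicBall

section AvgBusemannCritical

variable {n : ℕ}


/-! ### The surface measure: antipodal symmetry, positivity off an axis -/

/-- The surface measure of the unit sphere is invariant under the antipodal map `θ ↦ −θ`
(from `toSphere s = n · vol((0,1) • s)` and the `−`-invariance of Lebesgue measure). [folklore] -/
theorem measurePreserving_neg_toSphere :
    MeasurePreserving (fun θ : (sphere (0 : EuclideanSpace ℝ (Fin n)) 1) => -θ) (volume : Measure
        (EuclideanSpace ℝ (Fin n))).toSphere (volume : Measure (EuclideanSpace ℝ (Fin n))).toSphere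
        := by
  refine ⟨measurable_neg, Measure.ext fun s hs => ?_⟩
  rw [Measure.map_apply measurable_neg hs, Measure.toSphere_apply' _ (measurable_neg hs),
    Measure.toSphere_apply' _ hs]
  congr 1
  have h : (((↑) : (sphere (0 : EuclideanSpace ℝ (Fin n)) 1) → (EuclideanSpace ℝ (Fin n))) '' ((fun
      θ : (sphere (0 : EuclideanSpace ℝ (Fin n)) 1) => -θ) ⁻¹' s)) = -(((↑) : (sphere (0 :
      EuclideanSpace ℝ (Fin n)) 1) → (EuclideanSpace ℝ (Fin n))) '' s) := by
    ext x
    simp only [mem_image, mem_preimage, Set.mem_neg]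
    constructor
    · rintro ⟨θ, hθ, rfl⟩
      exact ⟨-θ, hθ, by simp⟩
    · rintro ⟨θ, hθ, hx⟩
      refine ⟨-θ, by simpa using hθ, ?_⟩
      simp [hx]
  rw [h, Set.smul_neg, Measure.measure_neg]

/-- Integrals over the unit sphere are invariant under `θ ↦ −θ`. [folklore] -/
theorem integral_comp_neg_toSphere {G : Type*} [NormedAddCommGroup G] [NormedSpace ℝ G]
    (F : (EuclideanSpace ℝ (Fin n)) → G) : ∫ θ, F (-↑θ) ∂(volume : Measure (EuclideanSpace ℝ (Fin
        n))).toSphere = ∫ θ, F θ ∂(volume : Measure (EuclideanSpace ℝ (Fin n))).toSphere := by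
  have hmp : MeasurePreserving (MeasurableEquiv.neg (sphere (0 : EuclideanSpace ℝ (Fin n)) 1))
      (volume : Measure (EuclideanSpace ℝ (Fin n))).toSphere (volume : Measure (EuclideanSpace ℝ
      (Fin n))).toSphere := measurePreserving_neg_toSphere
  have h := hmp.integral_comp' (fun θ : (sphere (0 : EuclideanSpace ℝ (Fin n)) 1) => F θ)
  simpa using h

/-- For `n ≥ 2` and `v ≠ 0` the directions off the axis `ℝv` have positive surface measure
(`volume.toSphere` charges every non-empty open subset of the sphere). [folklore] -/
theorem toSphere_offAxis_pos (hn : 2 ≤ n) {v : (EuclideanSpace ℝ (Fin n))} (hv : v ≠ 0) :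
    0 < (volume : Measure (EuclideanSpace ℝ (Fin n))).toSphere {θ : (sphere (0 : EuclideanSpace ℝ
        (Fin n)) 1) | ⟪↑θ, v⟫ ^ 2 < ‖v‖ ^ 2} := by
  obtain ⟨w, hw, hw0⟩ : ∃ w : (EuclideanSpace ℝ (Fin n)), ⟪w, v⟫ = 0 ∧ w ≠ 0 := by
    have h1 : (ℝ ∙ v)ᗮ ≠ ⊥ := by
      intro h
      rw [Submodule.orthogonal_eq_bot_iff] at h
      have h2 := finrank_span_singleton (K := ℝ) hv
      rw [h, finrank_top, finrank_euclideanSpace_fin] at h2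
      omega
    obtain ⟨w, hw, hw0⟩ := (Submodule.ne_bot_iff _).1 h1
    exact ⟨w, Submodule.mem_orthogonal_singleton_iff_inner_left.1 hw, hw0⟩
  refine (isOpen_lt
      (by fun_prop) (by fun_prop)).measure_pos (volume : Measure (EuclideanSpace ℝ (Fin n))).toSphere ⟨⟨‖w‖⁻¹ • w, ?_⟩, ?_⟩
  · simp [norm_smul, hw0]
  · have h0 : ⟪‖w‖⁻¹ • w, v⟫ = 0 := by rw [real_inner_smul_left, hw, mul_zero]
    have h1 : (0:ℝ) ^ 2 < ‖v‖ ^ 2 := by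
      rw [zero_pow two_ne_zero]; exact pow_pos (norm_pos_iff.2 hv) 2
    simpa [h0] using h1

/-- The total surface measure is positive (`n ≥ 1`). [folklore] -/
theorem toSphere_real_univ_pos (hn : 1 ≤ n) : 0 < (volume : Measure (EuclideanSpace ℝ (Fin
    n))).toSphere.real univ := by
  have hnt : Nontrivial (EuclideanSpace ℝ (Fin n)) := Module.finrank_pos_iff.1
      (by rw [finrank_euclideanSpace_fin]; omega)
  obtain ⟨v, hv⟩ := exists_ne (0 : EuclideanSpace ℝ (Fin n))
  have : Nonempty (sphere (0 : EuclideanSpace ℝ (Fin n)) 1) := ⟨⟨‖v‖⁻¹ • v,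
      by simp [norm_smul, hv]⟩⟩
  rw [measureReal_def]
  exact ENNReal.toReal_pos (isOpen_univ.measure_pos (volume : Measure (EuclideanSpace ℝ (Fin
      n))).toSphere univ_nonempty).ne' (measure_ne_top _ _)

/-! ### Calculus of the integrand `y ↦ log ‖y − θ‖²` -/

section Bilinear

/- Throughout this section `L` is the real inner product of `ℝⁿ` as Mathlib's genuinely bilinear
continuous map `(isBoundedBilinearMap_inner (𝕜 := ℝ)).toContinuousLinearMap : E →L[ℝ] E →L[ℝ] ℝ`
(`innerSL ℝ` is typed conjugate-semilinear in its first slot, which defeats rewriting once it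
appears as a bilinear object); `L` is a variable only to keep the statements readable. -/
variable {L} (hL : L = (isBoundedBilinearMap_inner (𝕜 := ℝ)
  (E := EuclideanSpace ℝ (Fin n))).toContinuousLinearMap)
include hL

/-- Evaluation of the bilinear inner-product map: `L v w = ⟪v, w⟫`. [folklore] -/
theorem bilin_apply_apply (v w : EuclideanSpace ℝ (Fin n)) : L v w = ⟪v, w⟫ := by
  subst hL; rfl

/-- `L v` is Mathlib's functional `innerSL ℝ v = ⟪v, ·⟫`. [folklore] -/
theorem bilin_eq_innerSL (v : EuclideanSpace ℝ (Fin n)) :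
    (L v : EuclideanSpace ℝ (Fin n) →L[ℝ] ℝ) = innerSL ℝ v :=
  ContinuousLinearMap.ext fun w =>
    (bilin_apply_apply hL v w).trans (innerSL_apply_apply (𝕜 := ℝ) v w).symm

/-- `‖⟪v, ·⟫‖ = ‖v‖` (Riesz). [folklore] -/
theorem norm_bilin_apply (v : EuclideanSpace ℝ (Fin n)) : ‖L v‖ = ‖v‖ := by
  rw [bilin_eq_innerSL hL, innerSL_apply_norm]

/-- `d/dy log ‖y − θ‖² = (2/‖y−θ‖²) ⟪y − θ, ·⟫` for `y ≠ θ`. [folklore] -/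
theorem hasFDerivAt_log_norm_sub_sq
    {θ y : EuclideanSpace ℝ (Fin n)} (h : y ≠ θ) :
    HasFDerivAt (fun x : (EuclideanSpace ℝ (Fin n)) => Real.log (‖x - θ‖ ^ 2))
      ((2 / ‖y - θ‖ ^ 2) • L (y - θ)) y := by
  have hne : ‖y - θ‖ ^ 2 ≠ 0 := pow_ne_zero 2 (norm_sub_pos_iff.2 h).ne'
  have h1 : HasFDerivAt (fun x : (EuclideanSpace ℝ (Fin n)) => ‖x - θ‖ ^ 2)
      (2 • (innerSL ℝ (y - θ)).comp (ContinuousLinearMap.id ℝ (EuclideanSpace ℝ (Fin n)))) y :=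
    ((hasFDerivAt_id y).sub_const θ).norm_sq
  refine (h1.log hne).congr_fderiv ?_
  ext v
  simp [bilin_apply_apply hL]
  ring

/-- `d/dy [(2/‖y−θ‖²) ⟪y−θ, ·⟫] = (2/‖y−θ‖²) ⟪·, ·⟫ − (4/‖y−θ‖⁴) ⟪y−θ, ·⟫ ⟪y−θ, ·⟫` for `y ≠ θ`.
[folklore] -/
theorem hasFDerivAt_grad_log_norm_sub_sq
    {θ y : EuclideanSpace ℝ (Fin n)} (h : y ≠ θ) :
    HasFDerivAt (fun x : (EuclideanSpace ℝ (Fin n)) => (2 / ‖x - θ‖ ^ 2) • L (x - θ))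
      ((2 / ‖y - θ‖ ^ 2) • L -
        (4 / ‖y - θ‖ ^ 4) • (L (y - θ)).smulRight (L (y - θ))) y := by
  have hne : ‖y - θ‖ ^ 2 ≠ 0 := pow_ne_zero 2 (norm_sub_pos_iff.2 h).ne'
  have h1 : HasFDerivAt (fun x : (EuclideanSpace ℝ (Fin n)) => ‖x - θ‖ ^ 2)
      (2 • (innerSL ℝ (y - θ)).comp (ContinuousLinearMap.id ℝ (EuclideanSpace ℝ (Fin n)))) y :=
    ((hasFDerivAt_id y).sub_const θ).norm_sq
  have h2 : HasFDerivAt (fun x : (EuclideanSpace ℝ (Fin n)) => 2 / ‖x - θ‖ ^ 2) _ y :=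
    (((hasDerivAt_inv hne).comp_hasFDerivAt y h1).const_smul (2 : ℝ)).congr_of_eventuallyEq
      (Eventually.of_forall fun x => by simp [div_eq_mul_inv])
  have h3 : HasFDerivAt (fun x : (EuclideanSpace ℝ (Fin n)) => L (x - θ))
      (L.comp (ContinuousLinearMap.id ℝ (EuclideanSpace ℝ (Fin n)))) y :=
    L.hasFDerivAt.comp y ((hasFDerivAt_id y).sub_const θ)
  refine (h2.smul h3).congr_fderiv ?_
  ext v w
  simp [bilin_apply_apply hL]
  ring

/-- `‖(2/‖y−θ‖²) ⟪y−θ, ·⟫‖ ≤ 2/‖y−θ‖`. [folklore] -/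
theorem norm_grad_log_norm_sub_sq_le (θ y : EuclideanSpace ℝ (Fin n)) :
    ‖(2 / ‖y - θ‖ ^ 2) • L (y - θ)‖ ≤ 2 / ‖y - θ‖ := by
  rw [norm_smul (2 / ‖y - θ‖ ^ 2) (L (y - θ)), norm_bilin_apply hL,
    Real.norm_of_nonneg (by positivity)]
  by_cases h0 : ‖y - θ‖ = 0
  · simp [h0]
  · apply le_of_eq
    field_simp

/-- Evaluation of the Hessian form: `(2/‖y−θ‖²) ⟪v, w⟫ − (4/‖y−θ‖⁴) ⟪y−θ, v⟫ ⟪y−θ, w⟫`.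
[folklore] -/
theorem hess_log_norm_sub_sq_apply (θ y v w : EuclideanSpace ℝ (Fin n)) :
    (((2 / ‖y - θ‖ ^ 2) • L -
        (4 / ‖y - θ‖ ^ 4) • (L (y - θ)).smulRight (L (y - θ))) v) w =
      2 / ‖y - θ‖ ^ 2 * ⟪v, w⟫ - 4 / ‖y - θ‖ ^ 4 * (⟪y - θ, v⟫ * ⟪y - θ, w⟫) := by
  simp only [sub_apply, smul_apply, ContinuousLinearMap.smulRight_apply, bilin_apply_apply hL,
    smul_eq_mul]

/-- `‖(2/‖y−θ‖²) ⟪·, ·⟫ − (4/‖y−θ‖⁴) ⟪y−θ, ·⟫ ⟪y−θ, ·⟫‖ ≤ 6/‖y−θ‖²`. [folklore] -/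
theorem norm_hess_log_norm_sub_sq_le
    {θ y : EuclideanSpace ℝ (Fin n)} (h : y ≠ θ) :
    ‖(2 / ‖y - θ‖ ^ 2) • L -
        (4 / ‖y - θ‖ ^ 4) • (L (y - θ)).smulRight (L (y - θ))‖ ≤
      6 / ‖y - θ‖ ^ 2 := by
  have ha : 0 < ‖y - θ‖ := norm_sub_pos_iff.2 h
  refine ContinuousLinearMap.opNorm_le_bound _ (by positivity) fun v => ?_
  refine ContinuousLinearMap.opNorm_le_bound _ (by positivity) fun w => ?_
  rw [hess_log_norm_sub_sq_apply hL, Real.norm_eq_abs]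
  have h1 : |⟪v, w⟫| ≤ ‖v‖ * ‖w‖ := abs_real_inner_le_norm v w
  have h2 : |⟪y - θ, v⟫| ≤ ‖y - θ‖ * ‖v‖ := abs_real_inner_le_norm _ _
  have h3 : |⟪y - θ, w⟫| ≤ ‖y - θ‖ * ‖w‖ := abs_real_inner_le_norm _ _
  calc |2 / ‖y - θ‖ ^ 2 * ⟪v, w⟫ - 4 / ‖y - θ‖ ^ 4 * (⟪y - θ, v⟫ * ⟪y - θ, w⟫)|
      ≤ |2 / ‖y - θ‖ ^ 2 * ⟪v, w⟫| + |4 / ‖y - θ‖ ^ 4 * (⟪y - θ, v⟫ * ⟪y - θ, w⟫)| :=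
        abs_sub _ _
    _ = 2 / ‖y - θ‖ ^ 2 * |⟪v, w⟫| + 4 / ‖y - θ‖ ^ 4 * (|⟪y - θ, v⟫| * |⟪y - θ, w⟫|) := by
        rw [abs_mul, abs_mul, abs_mul, abs_of_pos (by positivity : (0:ℝ) < 2 / ‖y - θ‖ ^ 2),
          abs_of_pos (by positivity : (0:ℝ) < 4 / ‖y - θ‖ ^ 4)]
    _ ≤ 2 / ‖y - θ‖ ^ 2 * (‖v‖ * ‖w‖) +
          4 / ‖y - θ‖ ^ 4 * ((‖y - θ‖ * ‖v‖) * (‖y - θ‖ * ‖w‖)) := by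
        gcongr
    _ = 6 / ‖y - θ‖ ^ 2 * ‖v‖ * ‖w‖ := by
        field_simp
        ring

omit hL in
/-- The elementary identity/inequality behind uniqueness (pairing `θ` with `−θ`): for
`s² ≤ q < 1`, `2(q−s)/(q−2s+1) + 2(q+s)/(q+2s+1) + 4q/(1−q) = 8(1+q)(q−s²)/((q−2s+1)(q+2s+1)(1−q)) ≥ 0`,
strictly if `s² < q`. [folklore] -/
theorem radial_pair_nonneg {q s : ℝ} (hq : q < 1) (hs : s ^ 2 ≤ q) :
    0 ≤ 2 / (q - 2 * s + 1) * (q - s) + 2 / (q + 2 * s + 1) * (q + s) + 4 * q / (1 - q) ∧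
      (s ^ 2 < q →
        0 < 2 / (q - 2 * s + 1) * (q - s) + 2 / (q + 2 * s + 1) * (q + s) + 4 * q / (1 - q)) := by
  have hs1 : s < 1 := by nlinarith
  have hs2 : -1 < s := by nlinarith
  have ha : 0 < q - 2 * s + 1 := by nlinarith
  have hb : 0 < q + 2 * s + 1 := by nlinarith
  have hq1 : 0 < 1 - q := by linarith
  have hq0 : 0 ≤ q := le_trans (sq_nonneg s) hs
  have key : 2 / (q - 2 * s + 1) * (q - s) + 2 / (q + 2 * s + 1) * (q + s) + 4 * q / (1 - q) =
      8 * (1 + q) * (q - s ^ 2) / ((q - 2 * s + 1) * (q + 2 * s + 1) * (1 - q)) := by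
    field_simp
    ring
  rw [key]
  refine ⟨div_nonneg (mul_nonneg (by positivity) (by linarith)) (by positivity), fun hs' => ?_⟩
  exact div_pos (mul_pos (by positivity) (by linarith)) (by positivity)

/-! ### Differentiation under the integral sign on the sphere -/

omit hL in
/-- On the open ball, `y ≠ θ` for every `θ` on the unit sphere. [folklore] -/
theorem ne_coe_sphere_of_norm_lt_one {y : (EuclideanSpace ℝ (Fin n))} (hy : ‖y‖ < 1) (θ : (sphere
    (0 : EuclideanSpace ℝ (Fin n)) 1)) : y ≠ ↑θ := fun h => by
  rw [h, norm_eq_of_mem_sphere] at hy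
  exact lt_irrefl _ hy

omit hL in
/-- Continuity of `θ ↦ (2/‖x−θ‖²)⟪x−θ, ·⟫` on the sphere, for `x` off the sphere. [folklore] -/
theorem continuous_grad_sphere {x : (EuclideanSpace ℝ (Fin n))} (hx : ∀ θ : (sphere (0 :
    EuclideanSpace ℝ (Fin n)) 1), x ≠ ↑θ) :
    Continuous fun θ : (sphere (0 : EuclideanSpace ℝ (Fin n)) 1) => (2 / ‖x - ↑θ‖ ^ 2) • L (x - ↑θ)
        :=
  (continuous_const.div (by fun_prop) fun θ => pow_ne_zero 2 (norm_sub_pos_iff.2 (hx θ)).ne').smul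
    (by fun_prop)

omit hL in
/-- Continuity of `θ ↦ (2/‖x−θ‖²)⟪·,·⟫ − (4/‖x−θ‖⁴)⟪x−θ,·⟫⟪x−θ,·⟫` on the sphere, for `x` off
the sphere. [folklore] -/
theorem continuous_hess_sphere {x : (EuclideanSpace ℝ (Fin n))} (hx : ∀ θ : (sphere (0 :
    EuclideanSpace ℝ (Fin n)) 1), x ≠ ↑θ) :
    Continuous fun θ : (sphere (0 : EuclideanSpace ℝ (Fin n)) 1) => (2 / ‖x - ↑θ‖ ^ 2) • L -
      (4 / ‖x - ↑θ‖ ^ 4) • (L (x - θ)).smulRight (L (x - θ)) := by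
  have hc1 : Continuous fun θ : (sphere (0 : EuclideanSpace ℝ (Fin n)) 1) => 2 / ‖x - ↑θ‖ ^ 2 :=
    continuous_const.div (by fun_prop) fun θ => pow_ne_zero 2 (norm_sub_pos_iff.2 (hx θ)).ne'
  have hc2 : Continuous fun θ : (sphere (0 : EuclideanSpace ℝ (Fin n)) 1) => 4 / ‖x - ↑θ‖ ^ 4 :=
    continuous_const.div (by fun_prop) fun θ => pow_ne_zero 4 (norm_sub_pos_iff.2 (hx θ)).ne'
  have hc3 : Continuous fun θ : (sphere (0 : EuclideanSpace ℝ (Fin n)) 1) => L (x - ↑θ) :=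
      by fun_prop
  have hc4 : Continuous fun θ : (sphere (0 : EuclideanSpace ℝ (Fin n)) 1) => (L (x - ↑θ)).smulRight
      (L (x - ↑θ)) :=
    isBoundedBilinearMap_smulRight.continuous.comp (hc3.prodMk hc3)
  exact (hc1.smul continuous_const).sub (hc2.smul hc4)

/-- Differentiation under the integral sign for `U(y) = ∫_S log ‖y − θ‖² dσ(θ)` on the open
unit ball (the Euclidean content of Itoh–Satoh Def. 5 (iv): `∇B_μ = ∫ ∇B_θ dμ`), by dominated
differentiation on the compact sphere. [folklore] -/
theorem hasFDerivAt_integral_log_norm_sub_sq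
    {y : EuclideanSpace ℝ (Fin n)} (hy : ‖y‖ < 1) :
    HasFDerivAt (fun x : (EuclideanSpace ℝ (Fin n)) => ∫ θ, Real.log (‖x - θ‖ ^ 2) ∂(volume :
        Measure (EuclideanSpace ℝ (Fin n))).toSphere)
      (∫ θ, (2 / ‖y - θ‖ ^ 2) • L (y - ↑θ) ∂(volume : Measure (EuclideanSpace ℝ (Fin n))).toSphere)
          y := by
  set ε := (1 - ‖y‖) / 2 with hε_def
  have hε : 0 < ε := by rw [hε_def]; linarith
  have hdist : ∀ x ∈ ball y ε, ∀ θ : (sphere (0 : EuclideanSpace ℝ (Fin n)) 1), ε ≤ ‖x - ↑θ‖ := by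
    intro x hx θ
    have h1 : ‖(θ : EuclideanSpace ℝ (Fin n))‖ = 1 := norm_eq_of_mem_sphere θ
    have h2 : ‖x - y‖ < ε := mem_ball_iff_norm.1 hx
    have h3 : ‖x‖ ≤ ‖y‖ + ‖x - y‖ := norm_le_insert' x y
    have h4 : ‖(θ : EuclideanSpace ℝ (Fin n))‖ - ‖x‖ ≤ ‖x - ↑θ‖ := by
      rw [norm_sub_rev]; exact norm_sub_norm_le _ _
    rw [hε_def] at h2 ⊢
    linarith
  have hne : ∀ x ∈ ball y ε, ∀ θ : (sphere (0 : EuclideanSpace ℝ (Fin n)) 1), x ≠ ↑θ := by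
    intro x hx θ hxθ
    have := hdist x hx θ
    rw [hxθ, sub_self, norm_zero] at this
    exact absurd this (not_le.2 hε)
  refine hasFDerivAt_integral_of_dominated_of_fderiv_le (𝕜 := ℝ) (μ := (volume : Measure
      (EuclideanSpace ℝ (Fin n))).toSphere)
    (F := fun (x : (EuclideanSpace ℝ (Fin n))) (θ : (sphere (0 : EuclideanSpace ℝ (Fin n)) 1)) =>
        Real.log (‖x - θ‖ ^ 2))
    (F' := fun (x : (EuclideanSpace ℝ (Fin n))) (θ : (sphere (0 : EuclideanSpace ℝ (Fin n)) 1)) =>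
        (2 / ‖x - θ‖ ^ 2) • L (x - ↑θ))
    (bound := fun _ => 2 / ε) (ball_mem_nhds y hε) ?_ ?_ ?_ ?_ ?_ ?_
  · exact Eventually.of_forall fun x =>
      (Real.measurable_log.comp (by fun_prop)).aestronglyMeasurable
  · have hc : Continuous fun θ : (sphere (0 : EuclideanSpace ℝ (Fin n)) 1) => Real.log (‖y - ↑θ‖ ^
      2) :=
      Continuous.log (by fun_prop) fun θ =>
        pow_ne_zero 2 (norm_sub_pos_iff.2 (hne y (mem_ball_self hε) θ)).ne'
    exact hc.integrable_of_hasCompactSupport (HasCompactSupport.of_compactSpace _)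
  · exact (continuous_grad_sphere (hne y (mem_ball_self hε))).aestronglyMeasurable
  · refine Eventually.of_forall fun θ x hx => ?_
    calc ‖(2 / ‖x - ↑θ‖ ^ 2) • L (x - ↑θ)‖ ≤ 2 / ‖x - ↑θ‖ :=
          norm_grad_log_norm_sub_sq_le hL _ _
      _ ≤ 2 / ε := by
          gcongr
          exact hdist x hx θ
  · exact integrable_const _
  · exact Eventually.of_forall fun θ x hx => hasFDerivAt_log_norm_sub_sq hL (hne x hx θ)

/-- Differentiation under the integral sign for `∇U(y) = ∫_S (2/‖y−θ‖²)⟪y−θ, ·⟫ dσ(θ)` at the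
origin (the Euclidean content of Itoh–Satoh Def. 5 (v): `∇dB_μ = ∫ ∇dB_θ dμ`). [folklore] -/
theorem hasFDerivAt_integral_grad_log_norm_sub_sq :
    HasFDerivAt (fun x : (EuclideanSpace ℝ (Fin n)) => ∫ θ, (2 / ‖x - θ‖ ^ 2) • L (x - ↑θ) ∂(volume
        : Measure (EuclideanSpace ℝ (Fin n))).toSphere)
      (∫ θ, ((2 / ‖(0 : EuclideanSpace ℝ (Fin n)) - θ‖ ^ 2) • L -
        (4 / ‖(0 : EuclideanSpace ℝ (Fin n)) - θ‖ ^ 4) • (L ((0 : EuclideanSpace ℝ (Fin n)) -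
            θ)).smulRight (L ((0 : EuclideanSpace ℝ (Fin n)) - θ)))
        ∂(volume : Measure (EuclideanSpace ℝ (Fin n))).toSphere) 0 := by
  have hdist : ∀ x ∈ ball (0 : EuclideanSpace ℝ (Fin n)) (1 / 2), ∀ θ : (sphere (0 : EuclideanSpace
      ℝ (Fin n)) 1), 1 / 2 ≤ ‖x - ↑θ‖ := by
    intro x hx θ
    have h1 : ‖(θ : EuclideanSpace ℝ (Fin n))‖ = 1 := norm_eq_of_mem_sphere θ
    have h2 : ‖x‖ < 1 / 2 := mem_ball_zero_iff.1 hx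
    have h4 : ‖(θ : EuclideanSpace ℝ (Fin n))‖ - ‖x‖ ≤ ‖x - ↑θ‖ := by
      rw [norm_sub_rev]; exact norm_sub_norm_le _ _
    linarith
  have hne : ∀ x ∈ ball (0 : EuclideanSpace ℝ (Fin n)) (1 / 2), ∀ θ : (sphere (0 : EuclideanSpace ℝ
      (Fin n)) 1), x ≠ ↑θ := by
    intro x hx θ hxθ
    have := hdist x hx θ
    rw [hxθ, sub_self, norm_zero] at this
    linarith
  have h0 : (0 : EuclideanSpace ℝ (Fin n)) ∈ ball (0 : EuclideanSpace ℝ (Fin n)) (1 / 2) :=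
      mem_ball_self one_half_pos
  refine hasFDerivAt_integral_of_dominated_of_fderiv_le (𝕜 := ℝ) (μ := (volume : Measure
      (EuclideanSpace ℝ (Fin n))).toSphere)
    (F := fun (x : (EuclideanSpace ℝ (Fin n))) (θ : (sphere (0 : EuclideanSpace ℝ (Fin n)) 1)) =>
        (2 / ‖x - θ‖ ^ 2) • L (x - ↑θ))
    (F' := fun (x : (EuclideanSpace ℝ (Fin n))) (θ : (sphere (0 : EuclideanSpace ℝ (Fin n)) 1)) =>
        (2 / ‖x - ↑θ‖ ^ 2) • L -
      (4 / ‖x - ↑θ‖ ^ 4) • (L (x - θ)).smulRight (L (x - θ)))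
    (bound := fun _ => 24) (ball_mem_nhds (0 : EuclideanSpace ℝ (Fin n)) one_half_pos) ?_ ?_ ?_ ?_
        ?_ ?_
  · filter_upwards [ball_mem_nhds (0 : EuclideanSpace ℝ (Fin n)) one_half_pos] with x hx
    exact (continuous_grad_sphere (hne x hx)).aestronglyMeasurable
  · exact (continuous_grad_sphere (hne 0 h0)).integrable_of_hasCompactSupport
      (HasCompactSupport.of_compactSpace _)
  · exact (continuous_hess_sphere (hne 0 h0)).aestronglyMeasurable
  · refine Eventually.of_forall fun θ x hx => ?_
    calc ‖(2 / ‖x - ↑θ‖ ^ 2) • L -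
            (4 / ‖x - ↑θ‖ ^ 4) • (L (x - θ)).smulRight (L (x - θ))‖
        ≤ 6 / ‖x - ↑θ‖ ^ 2 := norm_hess_log_norm_sub_sq_le hL (hne x hx θ)
      _ ≤ 6 / (1 / 2) ^ 2 := by
          gcongr
          exact hdist x hx θ
      _ = 24 := by norm_num
  · exact integrable_const _
  · exact Eventually.of_forall fun θ x hx => hasFDerivAt_grad_log_norm_sub_sq hL (hne x hx θ)

/-! ### The average Busemann function on the ball and its first two derivatives -/

omit hL in
/-- On the open ball, `B_{σ̄}(x) = (σ(S))⁻¹ ∫_S log ‖x − θ‖² dσ(θ) − log (1 − ‖x‖²)`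
(from `B_θ(x) = log(‖x−θ‖²/(1−‖x‖²))`, Itoh–Satoh Ex. 2 in the ball model). [cite: ItohSatoh2015, Def. 5] -/
theorem avgBusemann_eq_of_norm_lt_one (hn : 1 ≤ n) {x : (EuclideanSpace ℝ (Fin n))} (hx : ‖x‖ < 1) :
    avgBusemann n x =
      ((volume : Measure (EuclideanSpace ℝ (Fin n))).toSphere.real univ)⁻¹ • (∫ θ, Real.log (‖x -
          θ‖ ^ 2) ∂(volume : Measure (EuclideanSpace ℝ (Fin n))).toSphere) - Real.log (1 - ‖x‖ ^ 2)
          := by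
  have hθ : ∀ θ : (sphere (0 : EuclideanSpace ℝ (Fin n)) 1), ‖x - ↑θ‖ ^ 2 ≠ 0 := fun θ =>
    pow_ne_zero 2 (norm_sub_pos_iff.2 (ne_coe_sphere_of_norm_lt_one hx θ)).ne'
  have hx2 : 1 - ‖x‖ ^ 2 ≠ 0 := by nlinarith [norm_nonneg x]
  have hm : 0 < (volume : Measure (EuclideanSpace ℝ (Fin n))).toSphere.real univ :=
      toSphere_real_univ_pos hn
  have hint : Integrable (fun θ : (sphere (0 : EuclideanSpace ℝ (Fin n)) 1) => Real.log (‖x - ↑θ‖ ^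
      2)) (volume : Measure (EuclideanSpace ℝ (Fin n))).toSphere :=
    (Continuous.log (by fun_prop) hθ).integrable_of_hasCompactSupport
      (HasCompactSupport.of_compactSpace _)
  unfold avgBusemann
  rw [average_eq]
  have h1 : (fun θ : (sphere (0 : EuclideanSpace ℝ (Fin n)) 1) => Real.log (‖x - ↑θ‖ ^ 2 / (1 - ‖x‖
      ^ 2))) =
      fun θ : (sphere (0 : EuclideanSpace ℝ (Fin n)) 1) => Real.log (‖x - ↑θ‖ ^ 2) - Real.log (1 -
          ‖x‖ ^ 2) := by
    funext θ; rw [Real.log_div (hθ θ) hx2]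
  rw [h1, integral_sub hint (integrable_const _), integral_const, smul_eq_mul, smul_eq_mul,
    smul_eq_mul, mul_sub, ← mul_assoc, inv_mul_cancel₀ hm.ne', one_mul]

/-- **First derivative of `B_{σ̄}` on the ball** (Itoh–Satoh Def. 5 (iv), `∇B_μ = ∫ ∇B_θ dμ`,
for `μ = σ̄` on `ℍⁿ(ℝ)`):
`dB_{σ̄}(y) = (σ(S))⁻¹ ∫_S (2/‖y−θ‖²)⟪y−θ, ·⟫ dσ(θ) + (2/(1−‖y‖²))⟪y, ·⟫`.
[cite: ItohSatoh2015, Def. 5 (iv)] -/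
theorem hasFDerivAt_avgBusemann (hn : 1 ≤ n)
    {y : EuclideanSpace ℝ (Fin n)} (hy : ‖y‖ < 1) :
    HasFDerivAt (avgBusemann n)
      (((volume : Measure (EuclideanSpace ℝ (Fin n))).toSphere.real univ)⁻¹ • (∫ θ, (2 / ‖y - θ‖ ^
          2) • L (y - ↑θ) ∂(volume : Measure (EuclideanSpace ℝ (Fin n))).toSphere) +
        (2 / (1 - ‖y‖ ^ 2)) • L y) y := by
  have heq : (fun x : (EuclideanSpace ℝ (Fin n)) => ((volume : Measure (EuclideanSpace ℝ (Fin
      n))).toSphere.real univ)⁻¹ • (∫ θ, Real.log (‖x - θ‖ ^ 2) ∂(volume : Measure (EuclideanSpace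
      ℝ (Fin n))).toSphere) -
      Real.log (1 - ‖x‖ ^ 2)) =ᶠ[𝓝 y] avgBusemann n := by
    filter_upwards [isOpen_ball.mem_nhds (mem_ball_zero_iff.2 hy)] with x hx
    exact (avgBusemann_eq_of_norm_lt_one hn (mem_ball_zero_iff.1 hx)).symm
  have hU := hasFDerivAt_integral_log_norm_sub_sq hL hy
  have hy2 : 1 - ‖y‖ ^ 2 ≠ 0 := by nlinarith [norm_nonneg y]
  have hW : HasFDerivAt (fun x : (EuclideanSpace ℝ (Fin n)) => Real.log (1 - ‖x‖ ^ 2))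
      (-((2 / (1 - ‖y‖ ^ 2)) • L y)) y := by
    have h1 : HasFDerivAt (fun x : (EuclideanSpace ℝ (Fin n)) => ‖x‖ ^ 2) (2 • innerSL ℝ y) y :=
      (hasStrictFDerivAt_norm_sq y).hasFDerivAt
    refine ((h1.const_sub 1).log hy2).congr_fderiv ?_
    ext v
    simp [bilin_apply_apply hL]
    ring
  refine (((hU.const_smul ((volume : Measure (EuclideanSpace ℝ (Fin n))).toSphere.real univ)⁻¹).sub
      hW).congr_of_eventuallyEq heq.symm).congr_fderiv
    ?_
  rw [sub_neg_eq_add]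

/-- **Second derivative of `B_{σ̄}` at the origin** (Itoh–Satoh Def. 5 (v), `∇dB_μ = ∫ ∇dB_θ dμ`,
for `μ = σ̄` on `ℍⁿ(ℝ)` at the point `0`, where the Riemannian Hessian is the Euclidean one):
`D(dB_{σ̄})(0) = (σ(S))⁻¹ ∫_S (2⟪·,·⟫ − 4⟪θ,·⟫⟪θ,·⟫) dσ(θ) + 2⟪·,·⟫`.
[cite: ItohSatoh2015, Def. 5 (v)] -/
theorem hasFDerivAt_fderiv_avgBusemann (hn : 1 ≤ n) :
    HasFDerivAt (fderiv ℝ (avgBusemann n))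
      (((volume : Measure (EuclideanSpace ℝ (Fin n))).toSphere.real univ)⁻¹ • (∫ θ, ((2 / ‖(0 :
          EuclideanSpace ℝ (Fin n)) - θ‖ ^ 2) • L -
          (4 / ‖(0 : EuclideanSpace ℝ (Fin n)) - θ‖ ^ 4) • (L ((0 : EuclideanSpace ℝ (Fin n)) -
              θ)).smulRight (L ((0 : EuclideanSpace ℝ (Fin n)) - θ)))
          ∂(volume : Measure (EuclideanSpace ℝ (Fin n))).toSphere) +
        (2 : ℝ) • L) 0 := by
  have heq : (fun y : (EuclideanSpace ℝ (Fin n)) => ((volume : Measure (EuclideanSpace ℝ (Fin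
      n))).toSphere.real univ)⁻¹ •
      (∫ θ, (2 / ‖y - θ‖ ^ 2) • L (y - ↑θ) ∂(volume : Measure (EuclideanSpace ℝ (Fin n))).toSphere)
          +
        (2 / (1 - ‖y‖ ^ 2)) • L y) =ᶠ[𝓝 (0 : EuclideanSpace ℝ (Fin n))] fderiv ℝ (avgBusemann n) :=
            by
    filter_upwards [ball_mem_nhds (0 : EuclideanSpace ℝ (Fin n)) one_pos] with y hy
    exact ((hasFDerivAt_avgBusemann hL hn (mem_ball_zero_iff.1 hy)).fderiv).symm
  have hU := hasFDerivAt_integral_grad_log_norm_sub_sq hL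
  have hW : HasFDerivAt (fun y : (EuclideanSpace ℝ (Fin n)) => (2 / (1 - ‖y‖ ^ 2)) • L y) ((2 : ℝ)
      • L) 0 := by
    have h1 : HasFDerivAt (fun y : (EuclideanSpace ℝ (Fin n)) => ‖y‖ ^ 2) (2 • innerSL ℝ (0 :
        EuclideanSpace ℝ (Fin n))) 0 :=
      (hasStrictFDerivAt_norm_sq _).hasFDerivAt
    have h10 : (fun y : (EuclideanSpace ℝ (Fin n)) => 1 - ‖y‖ ^ 2) 0 ≠ 0 := by simp
    have h2 : HasFDerivAt (fun y : (EuclideanSpace ℝ (Fin n)) => 2 / (1 - ‖y‖ ^ 2)) _ 0 :=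
      (((hasDerivAt_inv h10).comp_hasFDerivAt 0 (h1.const_sub 1)).const_smul (2 :
          ℝ)).congr_of_eventuallyEq
        (Eventually.of_forall fun y => by simp [div_eq_mul_inv])
    refine (h2.smul L.hasFDerivAt).congr_fderiv ?_
    ext v w
    simp
  exact ((hU.const_smul ((volume : Measure (EuclideanSpace ℝ (Fin n))).toSphere.real univ)⁻¹).add
      hW).congr_of_eventuallyEq heq.symm


/-! ### Ex. 5: the origin is a critical point (antipodal symmetry) -/

omit hL in
/-- `dB_{σ̄}(0) = 0`: `∫_S ⟪θ, ·⟫ dσ(θ) = 0` by the antipodal symmetry of `σ`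
(Itoh–Satoh Ex. 5: `bar(dθ) = x_o`, via `∫_{S^{n−1}} θᵢ dθ = 0`). [cite: ItohSatoh2015, Ex. 5] -/
theorem fderiv_avgBusemann_zero_aux :
    ((volume : Measure (EuclideanSpace ℝ (Fin n))).toSphere.real univ)⁻¹ • (∫ θ, (2 / ‖(0 :
        EuclideanSpace ℝ (Fin n)) - θ‖ ^ 2) • L ((0 : EuclideanSpace ℝ (Fin n)) - ↑θ) ∂(volume :
        Measure (EuclideanSpace ℝ (Fin n))).toSphere) +
        (2 / (1 - ‖(0 : EuclideanSpace ℝ (Fin n))‖ ^ 2)) • L (0 : EuclideanSpace ℝ (Fin n)) = 0 :=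
            by
  have h1 : (fun θ : (sphere (0 : EuclideanSpace ℝ (Fin n)) 1) => (2 / ‖(0 : EuclideanSpace ℝ (Fin
      n)) - θ‖ ^ 2) • L ((0 : EuclideanSpace ℝ (Fin n)) - ↑θ)) =
      fun θ : (sphere (0 : EuclideanSpace ℝ (Fin n)) 1) => -((2 : ℝ) • L ↑θ) := by
    funext θ
    have : ‖(θ : EuclideanSpace ℝ (Fin n))‖ = 1 := norm_eq_of_mem_sphere θ
    simp [this]
  have h2 : ∫ θ, L ↑θ ∂(volume : Measure (EuclideanSpace ℝ (Fin n))).toSphere = 0 := by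
    have h := integral_comp_neg_toSphere (n := n) (fun x : (EuclideanSpace ℝ (Fin n)) => L x)
    simp only [map_neg, integral_neg] at h
    have h3 : (2 : ℝ) • ∫ θ, L ↑θ ∂(volume : Measure (EuclideanSpace ℝ (Fin n))).toSphere = 0 := by
      rw [two_smul]; nth_rewrite 1 [← h]; exact neg_add_cancel _
    exact (smul_eq_zero.1 h3).resolve_left two_ne_zero
  rw [h1, integral_neg, integral_smul, h2]
  simp

/-! ### Thm 13 (uniqueness): the radial derivative is positive away from the origin -/

/-- **Uniqueness of the barycentre** (Itoh–Satoh Thm 13, whose proof runs along the geodesic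
through two putative critical points; here the radial geodesic from the barycentre `0`): for
`0 < ‖y‖ < 1` the radial derivative `dB_{σ̄}(y)[y]` is strictly positive. Pairing `θ` with `−θ`
(antipodal symmetry of `σ`) the integrand becomes
`8(1+|y|²)(|y|² − ⟪θ,y⟫²)/(‖y−θ‖²‖y+θ‖²(1−|y|²)) ≥ 0`, strictly positive off the axis `ℝy`, which has
positive measure for `n ≥ 2`. [cite: ItohSatoh2015, Thm 13] -/
theorem fderiv_avgBusemann_apply_self_pos (hn : 2 ≤ n)
    {y : EuclideanSpace ℝ (Fin n)} (hy : ‖y‖ < 1) (hy0 : y ≠ 0) :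
    0 < (((volume : Measure (EuclideanSpace ℝ (Fin n))).toSphere.real univ)⁻¹ • (∫ θ, (2 / ‖y - θ‖
        ^ 2) • L (y - ↑θ) ∂(volume : Measure (EuclideanSpace ℝ (Fin n))).toSphere) +
        (2 / (1 - ‖y‖ ^ 2)) • L y) y := by
  have hm : 0 < (volume : Measure (EuclideanSpace ℝ (Fin n))).toSphere.real univ :=
      toSphere_real_univ_pos (by omega)
  have hcm : ((volume : Measure (EuclideanSpace ℝ (Fin n))).toSphere.real univ)⁻¹ * (volume :
      Measure (EuclideanSpace ℝ (Fin n))).toSphere.real univ = 1 := inv_mul_cancel₀ hm.ne'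
  have hcpos : 0 < ((volume : Measure (EuclideanSpace ℝ (Fin n))).toSphere.real univ)⁻¹ :=
      inv_pos.2 hm
  have hθ1 : ∀ θ : (sphere (0 : EuclideanSpace ℝ (Fin n)) 1), ‖(θ : EuclideanSpace ℝ (Fin n))‖ = 1
      := fun θ => norm_eq_of_mem_sphere θ
  have hne : ∀ θ : (sphere (0 : EuclideanSpace ℝ (Fin n)) 1), y ≠ ↑θ :=
      ne_coe_sphere_of_norm_lt_one hy
  have hne' : ∀ θ : (sphere (0 : EuclideanSpace ℝ (Fin n)) 1), y ≠ -↑θ := fun θ h => by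
    rw [h, norm_neg, hθ1] at hy; exact lt_irrefl _ hy
  have hint : Integrable (fun θ : (sphere (0 : EuclideanSpace ℝ (Fin n)) 1) => (2 / ‖y - θ‖ ^ 2) •
      L (y - ↑θ)) (volume : Measure (EuclideanSpace ℝ (Fin n))).toSphere :=
    (continuous_grad_sphere hne).integrable_of_hasCompactSupport
      (HasCompactSupport.of_compactSpace _)
  rw [add_apply, smul_apply, ContinuousLinearMap.integral_apply hint, smul_apply]
  simp only [smul_apply, bilin_apply_apply hL, smul_eq_mul, real_inner_self_eq_norm_sq]
  -- the paired integrand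
  set q : ℝ := ‖y‖ ^ 2 with hq_def
  have hq : q < 1 := by rw [hq_def]; nlinarith [norm_nonneg y]
  have hgc : Continuous fun θ : (sphere (0 : EuclideanSpace ℝ (Fin n)) 1) => 2 / ‖y - ↑θ‖ ^ 2 * ⟪y
      - ↑θ, y⟫ :=
    (continuous_const.div (by fun_prop) fun θ =>
      pow_ne_zero 2 (norm_sub_pos_iff.2 (hne θ)).ne').mul (by fun_prop)
  have hgc' : Continuous fun θ : (sphere (0 : EuclideanSpace ℝ (Fin n)) 1) => 2 / ‖y - -↑θ‖ ^ 2 *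
      ⟪y - -↑θ, y⟫ :=
    (continuous_const.div (by fun_prop) fun θ =>
      pow_ne_zero 2 (norm_sub_pos_iff.2 (hne' θ)).ne').mul (by fun_prop)
  have hgi : Integrable (fun θ : (sphere (0 : EuclideanSpace ℝ (Fin n)) 1) => 2 / ‖y - ↑θ‖ ^ 2 * ⟪y
      - ↑θ, y⟫) (volume : Measure (EuclideanSpace ℝ (Fin n))).toSphere :=
    hgc.integrable_of_hasCompactSupport (HasCompactSupport.of_compactSpace _)
  have hgi' : Integrable (fun θ : (sphere (0 : EuclideanSpace ℝ (Fin n)) 1) => 2 / ‖y - -↑θ‖ ^ 2 *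
      ⟪y - -↑θ, y⟫) (volume : Measure (EuclideanSpace ℝ (Fin n))).toSphere :=
    hgc'.integrable_of_hasCompactSupport (HasCompactSupport.of_compactSpace _)
  have hsymm : ∫ θ, 2 / ‖y - -↑θ‖ ^ 2 * ⟪y - -↑θ, y⟫ ∂(volume : Measure (EuclideanSpace ℝ (Fin
      n))).toSphere =
      ∫ θ, 2 / ‖y - ↑θ‖ ^ 2 * ⟪y - ↑θ, y⟫ ∂(volume : Measure (EuclideanSpace ℝ (Fin n))).toSphere :=
    integral_comp_neg_toSphere (fun θ : (EuclideanSpace ℝ (Fin n)) => 2 / ‖y - θ‖ ^ 2 * ⟪y - θ, y⟫)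
  have key : ∀ θ : (sphere (0 : EuclideanSpace ℝ (Fin n)) 1),
      (0 ≤ 2 / ‖y - ↑θ‖ ^ 2 * ⟪y - ↑θ, y⟫ +
          2 / ‖y - -↑θ‖ ^ 2 * ⟪y - -↑θ, y⟫ + 4 * q / (1 - q)) ∧
        (⟪↑θ, y⟫ ^ 2 < ‖y‖ ^ 2 →
          0 < 2 / ‖y - ↑θ‖ ^ 2 * ⟪y - ↑θ, y⟫ +
            2 / ‖y - -↑θ‖ ^ 2 * ⟪y - -↑θ, y⟫ + 4 * q / (1 - q)) := by
    intro θ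
    have e1 : ‖y - ↑θ‖ ^ 2 = q - 2 * ⟪↑θ, y⟫ + 1 := by
      rw [norm_sub_sq_real, hθ1, real_inner_comm]; ring
    have e2 : ‖y - -↑θ‖ ^ 2 = q + 2 * ⟪↑θ, y⟫ + 1 := by
      rw [sub_neg_eq_add, norm_add_sq_real, hθ1, real_inner_comm]; ring
    have e3 : ⟪y - ↑θ, y⟫ = q - ⟪↑θ, y⟫ := by
      rw [inner_sub_left, real_inner_self_eq_norm_sq]
    have e4 : ⟪y - -↑θ, y⟫ = q + ⟪↑θ, y⟫ := by
      rw [sub_neg_eq_add, inner_add_left, real_inner_self_eq_norm_sq]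
    have hs : ⟪↑θ, y⟫ ^ 2 ≤ q := by
      have h := abs_real_inner_le_norm ↑θ y
      rw [hθ1, one_mul] at h
      rw [hq_def, ← sq_abs]
      exact pow_le_pow_left₀ (abs_nonneg _) h 2
    rw [e1, e2, e3, e4]
    exact radial_pair_nonneg hq hs
  have hSint : Integrable (fun θ : (sphere (0 : EuclideanSpace ℝ (Fin n)) 1) => 2 / ‖y - ↑θ‖ ^ 2 *
      ⟪y - ↑θ, y⟫ +
      2 / ‖y - -↑θ‖ ^ 2 * ⟪y - -↑θ, y⟫ + 4 * q / (1 - q)) (volume : Measure (EuclideanSpace ℝ (Fin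
          n))).toSphere :=
    (hgi.add hgi').add (integrable_const _)
  have hSpos : 0 < ∫ θ, (2 / ‖y - ↑θ‖ ^ 2 * ⟪y - ↑θ, y⟫ +
      2 / ‖y - -↑θ‖ ^ 2 * ⟪y - -↑θ, y⟫ + 4 * q / (1 - q)) ∂(volume : Measure (EuclideanSpace ℝ (Fin
          n))).toSphere := by
    refine (integral_pos_iff_support_of_nonneg (fun θ => (key θ).1) hSint).2 ?_
    exact (toSphere_offAxis_pos hn hy0).trans_le (measure_mono fun θ hθ => ((key θ).2 hθ).ne')
  have hA : ∫ θ, (2 / ‖y - ↑θ‖ ^ 2 * ⟪y - ↑θ, y⟫ +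
      2 / ‖y - -↑θ‖ ^ 2 * ⟪y - -↑θ, y⟫ + 4 * q / (1 - q)) ∂(volume : Measure (EuclideanSpace ℝ (Fin
          n))).toSphere =
      (∫ θ, (2 / ‖y - ↑θ‖ ^ 2 * ⟪y - ↑θ, y⟫ +
        2 / ‖y - -↑θ‖ ^ 2 * ⟪y - -↑θ, y⟫) ∂(volume : Measure (EuclideanSpace ℝ (Fin n))).toSphere)
            + ∫ _θ, 4 * q / (1 - q) ∂(volume : Measure (EuclideanSpace ℝ (Fin n))).toSphere :=
    integral_add (hgi.add hgi') (integrable_const _)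
  have hB : ∫ θ, (2 / ‖y - ↑θ‖ ^ 2 * ⟪y - ↑θ, y⟫ +
      2 / ‖y - -↑θ‖ ^ 2 * ⟪y - -↑θ, y⟫) ∂(volume : Measure (EuclideanSpace ℝ (Fin n))).toSphere =
      (∫ θ, 2 / ‖y - ↑θ‖ ^ 2 * ⟪y - ↑θ, y⟫ ∂(volume : Measure (EuclideanSpace ℝ (Fin n))).toSphere)
          +
        ∫ θ, 2 / ‖y - -↑θ‖ ^ 2 * ⟪y - -↑θ, y⟫ ∂(volume : Measure (EuclideanSpace ℝ (Fin
            n))).toSphere :=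
    integral_add hgi hgi'
  have hId : ∫ θ, (2 / ‖y - ↑θ‖ ^ 2 * ⟪y - ↑θ, y⟫ +
      2 / ‖y - -↑θ‖ ^ 2 * ⟪y - -↑θ, y⟫ + 4 * q / (1 - q)) ∂(volume : Measure (EuclideanSpace ℝ (Fin
          n))).toSphere =
      2 * (∫ θ, 2 / ‖y - ↑θ‖ ^ 2 * ⟪y - ↑θ, y⟫ ∂(volume : Measure (EuclideanSpace ℝ (Fin
          n))).toSphere) +
        (volume : Measure (EuclideanSpace ℝ (Fin n))).toSphere.real univ * (4 * q / (1 - q)) := by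
    rw [hA, hB, hsymm, integral_const, smul_eq_mul]
    ring
  have h2 : 2 * (((volume : Measure (EuclideanSpace ℝ (Fin n))).toSphere.real univ)⁻¹ * (∫ θ, 2 /
      ‖y - ↑θ‖ ^ 2 * ⟪y - ↑θ, y⟫ ∂(volume : Measure (EuclideanSpace ℝ (Fin n))).toSphere) +
      2 / (1 - ‖y‖ ^ 2) * ‖y‖ ^ 2) =
      ((volume : Measure (EuclideanSpace ℝ (Fin n))).toSphere.real univ)⁻¹ * ∫ θ, (2 / ‖y - ↑θ‖ ^ 2
          * ⟪y - ↑θ, y⟫ +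
        2 / ‖y - -↑θ‖ ^ 2 * ⟪y - -↑θ, y⟫ + 4 * q / (1 - q)) ∂(volume : Measure (EuclideanSpace ℝ
            (Fin n))).toSphere := by
    have h4 : ((volume : Measure (EuclideanSpace ℝ (Fin n))).toSphere.real univ)⁻¹ * ((volume :
        Measure (EuclideanSpace ℝ (Fin n))).toSphere.real univ * (4 * q / (1 - q))) = 4 * q / (1 -
        q) := by
      rw [← mul_assoc, hcm, one_mul]
    rw [hId, mul_add ((volume : Measure (EuclideanSpace ℝ (Fin n))).toSphere.real univ)⁻¹, h4,
        hq_def]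
    ring
  have h3 := mul_pos hcpos hSpos
  rw [← h2] at h3
  linarith

/-! ### Thm 14 (ii): the Hessian at the barycentre is positive definite -/

/-- **Positive definiteness of the average Hessian at the barycentre** (Itoh–Satoh Thm 14 (ii)
for `μ_{x_o} = dθ`, with Ex. 4: `∇dB_θ = g − dB_θ ⊗ dB_θ` on `ℍⁿ(ℝ)`):
`D²B_{σ̄}(0)[v,v] = (σ(S))⁻¹ ∫_S (4‖v‖² − 4⟪θ,v⟫²) dσ(θ) > 0` for `v ≠ 0`, `n ≥ 2`, positivity
because `σ` charges the directions off the axis `ℝv`. [cite: ItohSatoh2015, Thm 14 (ii)] -/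
theorem fderiv_fderiv_avgBusemann_pos (hn : 2 ≤ n)
    {v : EuclideanSpace ℝ (Fin n)} (hv : v ≠ 0) :
    0 < ((((volume : Measure (EuclideanSpace ℝ (Fin n))).toSphere.real univ)⁻¹ • (∫ θ, ((2 / ‖(0 :
        EuclideanSpace ℝ (Fin n)) - θ‖ ^ 2) • L -
          (4 / ‖(0 : EuclideanSpace ℝ (Fin n)) - θ‖ ^ 4) • (L ((0 : EuclideanSpace ℝ (Fin n)) -
              θ)).smulRight (L ((0 : EuclideanSpace ℝ (Fin n)) - θ)))
          ∂(volume : Measure (EuclideanSpace ℝ (Fin n))).toSphere) +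
        (2 : ℝ) • L) v) v := by
  have hm : 0 < (volume : Measure (EuclideanSpace ℝ (Fin n))).toSphere.real univ :=
      toSphere_real_univ_pos (by omega)
  have hcm : ((volume : Measure (EuclideanSpace ℝ (Fin n))).toSphere.real univ)⁻¹ * (volume :
      Measure (EuclideanSpace ℝ (Fin n))).toSphere.real univ = 1 := inv_mul_cancel₀ hm.ne'
  have hcpos : 0 < ((volume : Measure (EuclideanSpace ℝ (Fin n))).toSphere.real univ)⁻¹ :=
      inv_pos.2 hm
  have hθ1 : ∀ θ : (sphere (0 : EuclideanSpace ℝ (Fin n)) 1), ‖(θ : EuclideanSpace ℝ (Fin n))‖ = 1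
      := fun θ => norm_eq_of_mem_sphere θ
  have hne : ∀ θ : (sphere (0 : EuclideanSpace ℝ (Fin n)) 1), (0 : EuclideanSpace ℝ (Fin n)) ≠ ↑θ
      := ne_coe_sphere_of_norm_lt_one (by simp)
  have hcont := continuous_hess_sphere (L := L) hne
  rw [add_apply, add_apply, smul_apply, smul_apply,
    ContinuousLinearMap.integral_apply
      (hcont.integrable_of_hasCompactSupport (HasCompactSupport.of_compactSpace _)),
    ContinuousLinearMap.integral_apply
      ((hcont.clm_apply continuous_const).integrable_of_hasCompactSupport
        (HasCompactSupport.of_compactSpace _))]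
  simp only [hess_log_norm_sub_sq_apply hL, smul_apply, bilin_apply_apply hL, smul_eq_mul,
    real_inner_self_eq_norm_sq]
  have hId : (fun θ : (sphere (0 : EuclideanSpace ℝ (Fin n)) 1) => 2 / ‖(0 : EuclideanSpace ℝ (Fin
      n)) - θ‖ ^ 2 * ‖v‖ ^ 2 -
      4 / ‖(0 : EuclideanSpace ℝ (Fin n)) - θ‖ ^ 4 * (⟪(0 : EuclideanSpace ℝ (Fin n)) - θ, v⟫ * ⟪(0
          : EuclideanSpace ℝ (Fin n)) - θ, v⟫)) =
      fun θ : (sphere (0 : EuclideanSpace ℝ (Fin n)) 1) => (4 * ‖v‖ ^ 2 - 4 * ⟪↑θ, v⟫ ^ 2) - 2 *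
          ‖v‖ ^ 2 := by
    funext θ
    simp only [zero_sub, norm_neg, hθ1 θ, inner_neg_left]
    ring
  have hF : ∀ θ : (sphere (0 : EuclideanSpace ℝ (Fin n)) 1), 0 ≤ 4 * ‖v‖ ^ 2 - 4 * ⟪↑θ, v⟫ ^ 2 ∧
      (⟪↑θ, v⟫ ^ 2 < ‖v‖ ^ 2 → 0 < 4 * ‖v‖ ^ 2 - 4 * ⟪↑θ, v⟫ ^ 2) := by
    intro θ
    have hs : ⟪↑θ, v⟫ ^ 2 ≤ ‖v‖ ^ 2 := by
      have h := abs_real_inner_le_norm ↑θ v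
      rw [hθ1, one_mul] at h
      rw [← sq_abs]
      exact pow_le_pow_left₀ (abs_nonneg _) h 2
    exact ⟨by linarith, fun h => by linarith⟩
  have hFint : Integrable (fun θ : (sphere (0 : EuclideanSpace ℝ (Fin n)) 1) => 4 * ‖v‖ ^ 2 - 4 *
      ⟪↑θ, v⟫ ^ 2) (volume : Measure (EuclideanSpace ℝ (Fin n))).toSphere :=
    (Continuous.sub continuous_const (by fun_prop)).integrable_of_hasCompactSupport
      (HasCompactSupport.of_compactSpace _)
  have hFpos : 0 < ∫ θ, (4 * ‖v‖ ^ 2 - 4 * ⟪↑θ, v⟫ ^ 2) ∂(volume : Measure (EuclideanSpace ℝ (Fin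
      n))).toSphere :=
    (integral_pos_iff_support_of_nonneg (fun θ => (hF θ).1) hFint).2
      ((toSphere_offAxis_pos hn hv).trans_le (measure_mono fun θ hθ => ((hF θ).2 hθ).ne'))
  rw [hId, integral_sub hFint (integrable_const _), integral_const, smul_eq_mul, mul_sub,
    ← mul_assoc _ ((volume : Measure (EuclideanSpace ℝ (Fin n))).toSphere.real univ), hcm, one_mul]
  have h3 := mul_pos hcpos hFpos
  linarith

end Bilinear

/-! ### Assembly -/

/-- **Itoh–Satoh 2015, Thm 13 + Thm 14 (ii) + Ex. 5 for `X = ℍⁿ(ℝ)`, `μ = σ̄`** (discharge of the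
named fact `avgBusemann_critical_iff`): in the Poincaré ball, the `σ̄`-average Busemann function
has `y = 0` as its only critical point in `𝔹`, and its Hessian at `0` is positive definite.
[cite: ItohSatoh2015, Thm 13, Thm 14 (ii), Ex. 5] -/
theorem avgBusemann_critical_iff_holds : avgBusemann_critical_iff := by
  intro n hn
  have hn1 : 1 ≤ n := by omega
  refine ⟨fun y hy => ?_, fun v hv => ?_⟩
  · rw [mem_ball_zero_iff] at hy
    rw [(hasFDerivAt_avgBusemann rfl hn1 hy).fderiv]
    constructor
    · intro h0
      by_contra hy0
      have key := fderiv_avgBusemann_apply_self_pos rfl hn hy hy0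
      rw [h0] at key
      simp at key
    · rintro rfl
      exact fderiv_avgBusemann_zero_aux
  · rw [(hasFDerivAt_fderiv_avgBusemann rfl hn1).fderiv]
    exact fderiv_fderiv_avgBusemann_pos rfl hn hv

end AvgBusemannCritical

end Literature.Analysis.Potential.HyperbolicBall
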